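import Mathlib.Data.Real.Basic
import Mathlib.Data.Nat.Choose.Basic
import Mathlib.Algebra.BigOperators.Ring.Finset
import Mathlib.Algebra.BigOperators.Pi
import Mathlib.Data.Fintype.BigOperators
import Mathlib.Order.Interval.Finset.Nat
import Mathlib.Algebra.Order.BigOperators.Group.Finset
import Mathlib.Data.Nat.Choose.Sum
import Mathlib.Algebra.BigOperators.Intervals
import Mathlib.Algebra.Order.Field.Basic
import Mathlib.Tactic.FieldSimp
import Mathlib.Tactic.Ring
import Summits.PneNP.PneNP.Theorems.OneSliceSliceACZeroDefs

/-!
# Route OneSlice, crux `SliceACZero` (stmt-PneNP-2835), line `russo-window-ladder`: the slice coupling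

Stub `stub_sliceCoupling` of the skeleton `Summits/PneNP/PneNP/Cruxes/SliceACZero/Lines/russo-window-ladder.lean`.
For every Boolean `f` on the cube `ι → Bool` (`N = |ι|`), every `q ∈ [0,1]` and every `j ≤ N`,

`|E_{μ_q} f − a_j(f)| ≤ Σ_{(x,i) ∈ upPivotal f} w_{q,j}(|x|) / ((N − |x|)·C(N,|x|))`,

where `a_ℓ(f) = sliceAvg f ℓ` is the density of `f` on the Hamming slice `{|x| = ℓ}` and
`w_{q,j}(i) = hybridWeight N q j i` is the `Bin(N,q)`-mass of the levels `ℓ` whose monotone path to `j` crosses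
the edge layer `i → i+1`. The proof is the exact double count behind the Filmus–Mossel hybrid argument (the
Russo–Margulis formula read slice by slice):

* `E_{μ_q} f = Σ_ℓ B(ℓ)·a_ℓ` (group `{f = 1}` by weight) and `Σ_ℓ B(ℓ) = 1`, so
  `|E_{μ_q} f − a_j| ≤ Σ_ℓ B(ℓ)·|a_ℓ − a_j|`;
* the up-step coupling: counting the up-edges `(x,i)` (`|x| = ℓ`, `x_i = 0`) once by their lower endpoint and
  once by their upper endpoint, `(N−ℓ)·A_ℓ = Σ 1[f x = 1]` and `(ℓ+1)·A_{ℓ+1} = Σ 1[f (x + e_i) = 1]`, so the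
  difference is at most the number `β_ℓ` of pivotal up-edges from level `ℓ`; with `#slice_ℓ = C(N,ℓ)` and
  `(N−ℓ)·C(N,ℓ) = (ℓ+1)·C(N,ℓ+1)` this is `|a_{ℓ+1} − a_ℓ| ≤ β_ℓ/((N−ℓ)·C(N,ℓ))`;
* telescoping along `[min(ℓ,j), max(ℓ,j))` and exchanging the two finite sums: the edge layer `i` is crossed by
  exactly the levels of total mass `w_{q,j}(i)`; finally the sum over layers is regrouped as a sum over
  `upPivotal f`.

Vocabulary (`wt`, `prodWeight`, `prodAvg`, `sliceAvg`, `upPivotal`, `binomPMF`, `hybridWeight`) from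
`Summits.PneNP.PneNP.Theorems.OneSliceSliceACZeroDefs`. [folklore]
-/

noncomputable section

namespace Summit.PneNP.PneNP.Cruxes.SliceACZero.RussoWindowLadder

open scoped BigOperators
open Finset

set_option linter.dupNamespace false -- `Summit.PneNP.PneNP.…`: summit = sub-problem BY DESIGN (D-0017)

namespace SliceCoupling

variable {ι : Type} [Fintype ι] [DecidableEq ι]

/-! ### Weights of neighbours, sizes of slices -/

/-- Raising a zero coordinate to one raises the weight by one. [folklore] -/
theorem wt_update_true {x : ι → Bool} {i : ι} (hx : x i = false) :
    wt (Function.update x i true) = wt x + 1 := by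
  unfold wt
  have hset : (univ.filter fun k => Function.update x i true k = true) =
      insert i (univ.filter fun k => x k = true) := by
    ext k
    by_cases hki : k = i
    · subst hki; simp
    · simp [hki]
  rw [hset, card_insert_of_notMem (by simp [hx])]

/-- Lowering a one coordinate to zero lowers the weight by one. [folklore] -/
theorem wt_update_false {y : ι → Bool} {i : ι} (hy : y i = true) :
    wt (Function.update y i false) + 1 = wt y := by
  have h := wt_update_true (x := Function.update y i false) (i := i) (by simp)
  rw [Function.update_idem, ← hy, Function.update_eq_self] at h
  exact h.symm

omit [DecidableEq ι] in
/-- The number of zero coordinates of `x` is `N − |x|`. [folklore] -/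
theorem card_filter_eq_false (x : ι → Bool) :
    #(univ.filter fun i => x i = false) = Fintype.card ι - wt x := by
  have h := Finset.card_filter_add_card_filter_not (s := (univ : Finset ι)) (fun i => x i = true)
  rw [Finset.card_univ] at h
  simp only [Bool.not_eq_true] at h
  rw [wt]
  omega

/-- **Size of a Hamming slice**: `#{x : |x| = ℓ} = C(N, ℓ)` (the support bijection with `ℓ`-subsets).
[folklore] -/
theorem card_slice (ℓ : ℕ) :
    #(univ.filter fun x : ι → Bool => wt x = ℓ) = (Fintype.card ι).choose ℓ := by
  rw [← Finset.card_univ (α := ι), ← Finset.card_powersetCard]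
  refine Finset.card_bij (fun x _ => univ.filter fun i => x i = true) ?_ ?_ ?_
  · intro x hx
    rw [Finset.mem_powersetCard]
    exact ⟨Finset.filter_subset _ _, (Finset.mem_filter.1 hx).2⟩
  · intro x _ y _ h
    funext i
    have hi : i ∈ (univ.filter fun k => x k = true) ↔ i ∈ (univ.filter fun k => y k = true) := by rw [h]
    simp only [Finset.mem_filter, Finset.mem_univ, true_and] at hi
    exact Bool.eq_iff_iff.2 hi
  · intro s hs
    refine ⟨fun i => decide (i ∈ s), ?_, ?_⟩
    · rw [Finset.mem_filter, wt]
      refine ⟨Finset.mem_univ _, ?_⟩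
      rw [← (Finset.mem_powersetCard.1 hs).2]
      congr 1
      ext i
      simp
    · ext i
      simp

/-! ### `E_{μ_q} f = Σ_ℓ B(ℓ)·a_ℓ` -/

/-- **Grouping `{f = 1}` by weight**: `E_{μ_q} f = Σ_{ℓ ≤ N} B_{N,q}(ℓ)·a_ℓ(f)`. [folklore] -/
theorem prodAvg_eq_sum (q : ℝ) (f : (ι → Bool) → Bool) :
    prodAvg q f =
      ∑ ℓ ∈ range (Fintype.card ι + 1), binomPMF (Fintype.card ι) q ℓ * sliceAvg f ℓ := by
  rw [prodAvg, ← Finset.sum_fiberwise_of_maps_to (s := univ.filter fun x : ι → Bool => f x = true)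
    (t := range (Fintype.card ι + 1)) (g := wt)
    (fun x _ => mem_range.2 (Nat.lt_succ_of_le (wt_le_card x)))]
  refine Finset.sum_congr rfl fun ℓ hℓ => ?_
  have hℓN : ℓ ≤ Fintype.card ι := Nat.lt_succ_iff.1 (mem_range.1 hℓ)
  have hC : ((Fintype.card ι).choose ℓ : ℝ) ≠ 0 := by exact_mod_cast (Nat.choose_pos hℓN).ne'
  rw [Finset.sum_congr rfl (g := fun _ => q ^ ℓ * (1 - q) ^ (Fintype.card ι - ℓ))
      (fun x hx => by rw [prodWeight, (Finset.mem_filter.1 hx).2]),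
    Finset.sum_const, nsmul_eq_mul, Finset.filter_filter, sliceAvg, card_slice, binomPMF,
    show (univ.filter fun x : ι → Bool => f x = true ∧ wt x = ℓ) =
      univ.filter fun x => wt x = ℓ ∧ f x = true from Finset.filter_congr fun x _ => and_comm]
  field_simp

/-! ### The up-step coupling between consecutive slices -/

/-- The numerator of `sliceAvg` as a sum of indicators over the slice. [folklore] -/
theorem numer_eq_sum (f : (ι → Bool) → Bool) (ℓ : ℕ) :
    (#(univ.filter fun x : ι → Bool => wt x = ℓ ∧ f x = true) : ℝ) =
      ∑ x ∈ univ.filter (fun x : ι → Bool => wt x = ℓ), (if f x = true then (1 : ℝ) else 0) := by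
  rw [Finset.sum_boole, Finset.filter_filter]

/-- **Up-edges counted by their lower endpoint**: every point of slice `ℓ` has `N − ℓ` up-neighbours, so
`Σ_{(x,i) : |x| = ℓ, x_i = 0} F(x) = (N − ℓ)·Σ_{|x| = ℓ} F(x)`. [folklore] -/
theorem sum_upEdges_fst (ℓ : ℕ) (F : (ι → Bool) → ℝ) :
    ∑ p ∈ univ.filter (fun p : (ι → Bool) × ι => wt p.1 = ℓ ∧ p.1 p.2 = false), F p.1 =
      ((Fintype.card ι - ℓ : ℕ) : ℝ) * ∑ x ∈ univ.filter (fun x : ι → Bool => wt x = ℓ), F x := by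
  rw [Finset.sum_finset_product (univ.filter fun p : (ι → Bool) × ι => wt p.1 = ℓ ∧ p.1 p.2 = false)
      (univ.filter fun x : ι → Bool => wt x = ℓ) (fun x => univ.filter fun i => x i = false)
      (by intro p; simp only [Finset.mem_filter, Finset.mem_univ, true_and]),
    Finset.mul_sum]
  refine Finset.sum_congr rfl fun x hx => ?_
  dsimp only
  rw [Finset.sum_const, nsmul_eq_mul, card_filter_eq_false, (Finset.mem_filter.1 hx).2]

/-- **Up-edges counted by their upper endpoint**: `(x,i) ↦ (x + e_i, i)` is a bijection onto the down-edges
`(y,i)` (`|y| = ℓ+1`, `y_i = 1`), and every point of slice `ℓ+1` has `ℓ+1` down-neighbours, so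
`Σ_{(x,i) : |x| = ℓ, x_i = 0} F(x + e_i) = (ℓ+1)·Σ_{|y| = ℓ+1} F(y)`. [folklore] -/
theorem sum_upEdges_snd (ℓ : ℕ) (F : (ι → Bool) → ℝ) :
    ∑ p ∈ univ.filter (fun p : (ι → Bool) × ι => wt p.1 = ℓ ∧ p.1 p.2 = false),
        F (Function.update p.1 p.2 true) =
      ((ℓ + 1 : ℕ) : ℝ) * ∑ y ∈ univ.filter (fun y : ι → Bool => wt y = ℓ + 1), F y := by
  have hbij : ∑ p ∈ univ.filter (fun p : (ι → Bool) × ι => wt p.1 = ℓ ∧ p.1 p.2 = false),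
        F (Function.update p.1 p.2 true) =
      ∑ p ∈ univ.filter (fun p : (ι → Bool) × ι => wt p.1 = ℓ + 1 ∧ p.1 p.2 = true), F p.1 := by
    refine Finset.sum_nbij' (fun p => (Function.update p.1 p.2 true, p.2))
      (fun p => (Function.update p.1 p.2 false, p.2)) ?_ ?_ ?_ ?_ ?_
    · intro p hp
      obtain ⟨h1, h2⟩ := (Finset.mem_filter.1 hp).2
      refine Finset.mem_filter.2 ⟨Finset.mem_univ _, ?_, ?_⟩
      · dsimp only
        rw [wt_update_true h2, h1]
      · exact Function.update_self _ _ _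
    · intro p hp
      obtain ⟨h1, h2⟩ := (Finset.mem_filter.1 hp).2
      refine Finset.mem_filter.2 ⟨Finset.mem_univ _, ?_, ?_⟩
      · dsimp only
        have h3 := wt_update_false h2
        omega
      · exact Function.update_self _ _ _
    · intro p hp
      obtain ⟨-, h2⟩ := (Finset.mem_filter.1 hp).2
      refine Prod.ext ?_ rfl
      dsimp only
      rw [Function.update_idem, ← h2, Function.update_eq_self]
    · intro p hp
      obtain ⟨-, h2⟩ := (Finset.mem_filter.1 hp).2
      refine Prod.ext ?_ rfl
      dsimp only
      rw [Function.update_idem, ← h2, Function.update_eq_self]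
    · intro p _
      rfl
  rw [hbij, Finset.sum_finset_product
      (univ.filter fun p : (ι → Bool) × ι => wt p.1 = ℓ + 1 ∧ p.1 p.2 = true)
      (univ.filter fun y : ι → Bool => wt y = ℓ + 1) (fun y => univ.filter fun i => y i = true)
      (by intro p; simp only [Finset.mem_filter, Finset.mem_univ, true_and]),
    Finset.mul_sum]
  refine Finset.sum_congr rfl fun y hy => ?_
  dsimp only
  rw [Finset.sum_const, nsmul_eq_mul, show #(univ.filter fun i => y i = true) = wt y from rfl,
    (Finset.mem_filter.1 hy).2]

/-- The pivotal up-edges from slice `ℓ` are exactly the up-pivotal pairs of weight `ℓ`. [folklore] -/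
theorem filter_upEdges_pivotal (f : (ι → Bool) → Bool) (ℓ : ℕ) :
    (univ.filter (fun p : (ι → Bool) × ι => wt p.1 = ℓ ∧ p.1 p.2 = false)).filter
        (fun p => f p.1 ≠ f (Function.update p.1 p.2 true)) =
      (upPivotal f).filter (fun p => wt p.1 = ℓ) := by
  ext p
  simp only [upPivotal, Finset.mem_filter, Finset.mem_univ, true_and]
  tauto

/-- **Up-step coupling, counted**: `|(ℓ+1)·A_{ℓ+1} − (N−ℓ)·A_ℓ| ≤ β_ℓ`, the number of pivotal up-edges
from level `ℓ` (both products count the up-edges from level `ℓ` with `f = 1` at one endpoint; they differ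
only on bichromatic edges). [folklore] -/
theorem abs_sub_le_layer (f : (ι → Bool) → Bool) (ℓ : ℕ) :
    |((ℓ + 1 : ℕ) : ℝ) * #(univ.filter fun x : ι → Bool => wt x = ℓ + 1 ∧ f x = true) -
        ((Fintype.card ι - ℓ : ℕ) : ℝ) * #(univ.filter fun x : ι → Bool => wt x = ℓ ∧ f x = true)| ≤
      #((upPivotal f).filter fun p => wt p.1 = ℓ) := by
  rw [numer_eq_sum, numer_eq_sum, ← sum_upEdges_snd, ← sum_upEdges_fst, ← Finset.sum_sub_distrib]
  refine (Finset.abs_sum_le_sum_abs _ _).trans ?_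
  rw [← filter_upEdges_pivotal, Finset.natCast_card_filter]
  refine Finset.sum_le_sum fun p _ => ?_
  cases f p.1 <;> cases f (Function.update p.1 p.2 true) <;> simp

/-- `(ℓ+1)·C(N,ℓ+1) = (N−ℓ)·C(N,ℓ)` (in `ℝ`). [folklore] -/
theorem succ_mul_choose_succ (N ℓ : ℕ) :
    ((ℓ + 1 : ℕ) : ℝ) * (N.choose (ℓ + 1) : ℝ) = ((N - ℓ : ℕ) : ℝ) * (N.choose ℓ : ℝ) := by
  rw [mul_comm, mul_comm ((N - ℓ : ℕ) : ℝ)]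
  exact_mod_cast Nat.choose_succ_right_eq N ℓ

/-- **Up-step coupling**: `|a_{ℓ+1} − a_ℓ| ≤ β_ℓ / ((N−ℓ)·C(N,ℓ))` for `ℓ < N`. [folklore] -/
theorem abs_sliceAvg_succ_sub_le (f : (ι → Bool) → Bool) {ℓ : ℕ} (hℓ : ℓ < Fintype.card ι) :
    |sliceAvg f (ℓ + 1) - sliceAvg f ℓ| ≤
      (#((upPivotal f).filter fun p => wt p.1 = ℓ) : ℝ) /
        (((Fintype.card ι - ℓ : ℕ) : ℝ) * ((Fintype.card ι).choose ℓ : ℝ)) := by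
  have hNl : (0 : ℝ) < ((Fintype.card ι - ℓ : ℕ) : ℝ) := by exact_mod_cast Nat.sub_pos_of_lt hℓ
  have hC : (0 : ℝ) < ((Fintype.card ι).choose ℓ : ℝ) := by exact_mod_cast Nat.choose_pos hℓ.le
  have hD : (0 : ℝ) < ((Fintype.card ι - ℓ : ℕ) : ℝ) * ((Fintype.card ι).choose ℓ : ℝ) := mul_pos hNl hC
  have hl1 : ((ℓ + 1 : ℕ) : ℝ) ≠ 0 := by exact_mod_cast Nat.succ_ne_zero ℓ
  have e0 : sliceAvg f ℓ =
      ((Fintype.card ι - ℓ : ℕ) : ℝ) * #(univ.filter fun x : ι → Bool => wt x = ℓ ∧ f x = true) /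
        (((Fintype.card ι - ℓ : ℕ) : ℝ) * ((Fintype.card ι).choose ℓ : ℝ)) := by
    rw [sliceAvg, card_slice, mul_div_mul_left _ _ hNl.ne']
  have e1 : sliceAvg f (ℓ + 1) =
      ((ℓ + 1 : ℕ) : ℝ) * #(univ.filter fun x : ι → Bool => wt x = ℓ + 1 ∧ f x = true) /
        (((Fintype.card ι - ℓ : ℕ) : ℝ) * ((Fintype.card ι).choose ℓ : ℝ)) := by
    rw [sliceAvg, card_slice, ← succ_mul_choose_succ, mul_div_mul_left _ _ hl1]
  rw [e0, e1, ← sub_div, abs_div, abs_of_pos hD]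
  exact div_le_div_of_nonneg_right (abs_sub_le_layer f ℓ) hD.le

/-! ### Telescoping and exchange of summations -/

/-- **Telescoping** along the ladder: `|a_n − a_m| ≤ Σ_{i ∈ [m,n)} β_i/((N−i)·C(N,i))` for `m ≤ n ≤ N`.
[folklore] -/
theorem abs_sliceAvg_sub_le_sum_Ico (f : (ι → Bool) → Bool) {m n : ℕ} (hmn : m ≤ n)
    (hn : n ≤ Fintype.card ι) :
    |sliceAvg f n - sliceAvg f m| ≤
      ∑ i ∈ Ico m n, (#((upPivotal f).filter fun p => wt p.1 = i) : ℝ) /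
        (((Fintype.card ι - i : ℕ) : ℝ) * ((Fintype.card ι).choose i : ℝ)) := by
  induction n, hmn using Nat.le_induction with
  | base => simp
  | succ n hmn ih =>
    rw [Finset.sum_Ico_succ_top hmn]
    calc |sliceAvg f (n + 1) - sliceAvg f m|
        = |(sliceAvg f (n + 1) - sliceAvg f n) + (sliceAvg f n - sliceAvg f m)| := by
          rw [sub_add_sub_cancel]
      _ ≤ |sliceAvg f (n + 1) - sliceAvg f n| + |sliceAvg f n - sliceAvg f m| := abs_add_le _ _
      _ ≤ _ := by
          rw [add_comm]
          exact add_le_add (ih (Nat.le_of_succ_le hn)) (abs_sliceAvg_succ_sub_le f hn)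

/-- Telescoping between any two levels `ℓ, j ≤ N`, along `[min(ℓ,j), max(ℓ,j))`. [folklore] -/
theorem abs_sliceAvg_sub_le (f : (ι → Bool) → Bool) {ℓ j : ℕ} (hℓ : ℓ ≤ Fintype.card ι)
    (hj : j ≤ Fintype.card ι) :
    |sliceAvg f ℓ - sliceAvg f j| ≤
      ∑ i ∈ Ico (min ℓ j) (max ℓ j), (#((upPivotal f).filter fun p => wt p.1 = i) : ℝ) /
        (((Fintype.card ι - i : ℕ) : ℝ) * ((Fintype.card ι).choose i : ℝ)) := by
  rcases le_total ℓ j with h | h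
  · rw [min_eq_left h, max_eq_right h, abs_sub_comm]
    exact abs_sliceAvg_sub_le_sum_Ico f h hj
  · rw [min_eq_right h, max_eq_left h]
    exact abs_sliceAvg_sub_le_sum_Ico f h hℓ

/-- **Exchange of summations**: for `j ≤ N`, the layer `i < N` lies on the monotone path from `j` to exactly the
levels `ℓ` of total binomial mass `hybridWeight N q j i`. [folklore] -/
theorem sum_binomPMF_mul_sum_Ico (N : ℕ) (q : ℝ) {j : ℕ} (hj : j ≤ N) (c : ℕ → ℝ) :
    ∑ ℓ ∈ range (N + 1), binomPMF N q ℓ * ∑ i ∈ Ico (min ℓ j) (max ℓ j), c i =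
      ∑ i ∈ range N, c i * hybridWeight N q j i := by
  simp_rw [Finset.mul_sum]
  rw [Finset.sum_comm' (t' := range N) (s' := fun i => if j ≤ i then Ioc i N else range (i + 1))]
  · refine Finset.sum_congr rfl fun i _ => ?_
    rw [← Finset.sum_mul, mul_comm, hybridWeight]
    split_ifs <;> rfl
  · intro ℓ i
    simp only [Finset.mem_range, Finset.mem_Ico]
    split_ifs with h
    · simp only [Finset.mem_Ioc]
      omega
    · simp only [Finset.mem_range]
      omega

/-- **Regrouping by layer**: the sum over `upPivotal f` of a function of the weight is the sum over the layers
`i < N` weighted by `β_i`. [folklore] -/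
theorem sum_upPivotal_eq_sum_range (f : (ι → Bool) → Bool) (q : ℝ) (j : ℕ) :
    ∑ p ∈ upPivotal f, hybridWeight (Fintype.card ι) q j (wt p.1) /
        (((Fintype.card ι - wt p.1 : ℕ) : ℝ) * ((Fintype.card ι).choose (wt p.1) : ℝ)) =
      ∑ i ∈ range (Fintype.card ι), (#((upPivotal f).filter fun p => wt p.1 = i) : ℝ) /
        (((Fintype.card ι - i : ℕ) : ℝ) * ((Fintype.card ι).choose i : ℝ)) *
          hybridWeight (Fintype.card ι) q j i := by
  rw [← Finset.sum_fiberwise_of_maps_to (s := upPivotal f) (t := range (Fintype.card ι))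
    (g := fun p => wt p.1) (fun p hp => mem_range.2 (wt_lt_card_of_mem_upPivotal hp))]
  refine Finset.sum_congr rfl fun i _ => ?_
  rw [Finset.sum_congr rfl (g := fun _ => hybridWeight (Fintype.card ι) q j i /
        (((Fintype.card ι - i : ℕ) : ℝ) * ((Fintype.card ι).choose i : ℝ)))
      (fun p hp => by rw [(Finset.mem_filter.1 hp).2]),
    Finset.sum_const, nsmul_eq_mul]
  ring

end SliceCoupling

open SliceCoupling in
/-- **Stub 1 — slice coupling (the lever; exact combinatorics).** For every Boolean `f` on `{0,1}^ι`
(`N = |ι|`), every `q ∈ [0,1]` and every `j ≤ N`: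
`|E_{μ_q} f − a_j(f)| ≤ Σ_{(x,i) ∈ upPivotal f} w_{q,j}(|x|) / ((N − |x|)·C(N,|x|))`
(`E_{μ_q} f = Σ_ℓ B(ℓ)·a_ℓ`, `Σ_ℓ B = 1`, the up-step coupling `|a_{ℓ+1} − a_ℓ| ≤ β_ℓ/((N−ℓ)C(N,ℓ))`,
telescoping and exchange of summations; Filmus–Mossel hybrid argument / Russo–Margulis read slice by slice).
[folklore] -/
theorem stub_sliceCoupling :
    ∀ (ι : Type) [Fintype ι] [DecidableEq ι] (f : (ι → Bool) → Bool) (q : ℝ), 0 ≤ q → q ≤ 1 →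
      ∀ j : ℕ, j ≤ Fintype.card ι →
        |prodAvg q f - sliceAvg f j| ≤
          ∑ p ∈ upPivotal f, hybridWeight (Fintype.card ι) q j (wt p.1) /
            (((Fintype.card ι - wt p.1 : ℕ) : ℝ) * ((Fintype.card ι).choose (wt p.1) : ℝ)) := by
  intro ι _ _ f q hq0 hq1 j hj
  -- total binomial mass `Σ_{ℓ ≤ N} B_{N,q}(ℓ) = (q + (1 − q))^N = 1` (kept local: the named form is
  -- `BinomialHazard.sum_binomPMF` of the sibling file `OneSliceSliceACZeroBinomialHazard`)
  have hmass : ∑ ℓ ∈ range (Fintype.card ι + 1), binomPMF (Fintype.card ι) q ℓ = 1 := by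
    have h := add_pow q (1 - q) (Fintype.card ι)
    rw [add_sub_cancel, one_pow] at h
    rw [h]
    exact Finset.sum_congr rfl fun ℓ _ => by rw [binomPMF]; ring
  rw [sum_upPivotal_eq_sum_range, ← sum_binomPMF_mul_sum_Ico _ q hj, prodAvg_eq_sum]
  calc |∑ ℓ ∈ range (Fintype.card ι + 1), binomPMF (Fintype.card ι) q ℓ * sliceAvg f ℓ - sliceAvg f j|
      = |∑ ℓ ∈ range (Fintype.card ι + 1),
          binomPMF (Fintype.card ι) q ℓ * (sliceAvg f ℓ - sliceAvg f j)| := by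
        rw [Finset.sum_congr rfl fun ℓ _ => mul_sub (binomPMF (Fintype.card ι) q ℓ) (sliceAvg f ℓ)
          (sliceAvg f j), Finset.sum_sub_distrib, ← Finset.sum_mul, hmass, one_mul]
    _ ≤ ∑ ℓ ∈ range (Fintype.card ι + 1),
          |binomPMF (Fintype.card ι) q ℓ * (sliceAvg f ℓ - sliceAvg f j)| :=
        Finset.abs_sum_le_sum_abs _ _
    _ ≤ _ := by
        refine Finset.sum_le_sum fun ℓ hℓ => ?_
        rw [abs_mul, abs_of_nonneg (binomPMF_nonneg _ hq0 hq1 ℓ)]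
        exact mul_le_mul_of_nonneg_left
          (abs_sliceAvg_sub_le f (Nat.lt_succ_iff.1 (mem_range.1 hℓ)) hj) (binomPMF_nonneg _ hq0 hq1 ℓ)

end Summit.PneNP.PneNP.Cruxes.SliceACZero.RussoWindowLadder

end
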